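/-
Origin: expansion seat `planner-pub-hodgecm-pv11-g3-0`, handover #2 2026-08-18T06:17:20Z (`HOME/pub-hodgecm-pv11-g3/lean/Pv11g3/WeilKernelLaw.lean`, md5 930a3bd9, 116 lines);
landed by the gen-6 packager in gate run 24 as `HodgeCM/PerL34/WeilKernelLaw.lean` (verbatim).
-/
/-
Origin: HOME/pub-hodgecm-pv11-g3/lean/Pv11g3/WeilKernelLaw.lean — session planner-pub-hodgecm-pv11-g3-0
(unit pub-hodgecm-pv11-g3, DAG-NODE PROVER #11 gen 3).  Intended place: `HodgeCM/PerL34/WeilKernelLaw.lean`;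
imports only LANDED modules (no import rewrite).
-/
import Summits.HodgeConjecture.HodgeCM.PerL34.Seesaw
import Summits.HodgeConjecture.HodgeCM.Literature.WeilTheta1964

/-!
# The two analytic fields `cont` / `inv` of route (E), typed as ONE law over Weil 1964, Théorème 6

`SupplyAdelic.SupplyBridgeA` (gen 3 of route (E) ⇒ `Open_supply`) carries two PRINT-labelled fields about the
theta kernel `u ↦ θ_{φ_N}(g₀, u)` on `U(W_j)(𝔸)`:

* `cont : ∀ N, Continuous fun u => DS.thetaKernel₁ (φN N) g₀ u`,
* `inv  : ∀ N, ∀ γ ∈ rat, ∀ u, DS.thetaKernel₁ (φN N) g₀ (γ * u) = DS.thetaKernel₁ (φN N) g₀ u`.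

This file types the print sentence behind both — Weil, Acta Math. 111 (1964), n° 41, **Théorème 6**, p. 193,
LANDED verbatim as the named `Prop` `Literature.Theta.WeilThetaDatum.ThetaContinuousInvariant` — together with
the two non-print sentences that connect it to PerL's kernel, as a record `WeilKernelLaw DS Γ φN g₀` whose
projections `WeilKernelLaw.cont` / `WeilKernelLaw.inv` ARE the two fields verbatim (so an instantiation writes
`cont := law.cont, inv := law.inv`).  Field classes (referee 2, G-R2-14):

* `W`, `print` — **P by name**: a `WeilThetaDatum` (carriers `Mp(X)_A`, `S(X_A)`, `r_k(Ps(X)_k)`, `Θ`) and the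
  hypothesis `W.ThetaContinuousInvariant` (= Théorème 6 as printed; nothing else of Weil is used);
* `s`, `hs`, `hsΓ` — **class U** (print, not held verbatim: the Kudla / Harris–Kudla–Sweet splitting
  `U(W_j)(𝔸) → Mp(𝕎)_A`, `u ↦ s(u) = ι_χ(g₀, u)`, is continuous and carries a rational element `γ ∈ U(W_j)(L₀)` to
  `r_k(Ps_k) · s(u)` — it is a homomorphism agreeing with `r_k` on rational points; CITED-FACTS KHR-6b/6c,
  `ThetaCorrespondence.HKSRestrictionDatum.SplittingRestricts`; [Ku94 § 1], [HKS96 § 1], Ichino 2022 § 7.5);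
* `Φ`, `hF` — **DEF** (PerL v5 l. 266, the DEFINITION of the theta kernel: `θ_φ(g₀, u) = Θ_Φ(s(u))` with
  `Φ = φ_N ∈ S(X_A)`, `X = Res (V₃ ⊗ W_j)`).

KERNEL: `cont`, `inv` from the law (two lines each); and the law is CONSERVATIVE over the pair of fields it
replaces (`nonempty_iff`: the tautological datum `Mp := U(W_j)(𝔸)`, `S := ℕ`, `Θ_N := θ_{φ_N}(g₀, ·)` witnesses the
converse), so — as for every seam record of this package — its content is the LABELLING, here: which part of
"θ is a continuous automorphic kernel" is Weil's theorem, which is the splitting, which is a definition.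

No statement of the 2001 programme, of PerL or of QW8 is used or cited.
-/

set_option autoImplicit false

noncomputable section

open Topology

namespace HodgeCM
namespace PerL34

open Seesaw Literature.Theta

/-- **Weil-kernel law** for a theta shell `DS`, a subgroup `Γ ≤ U(W₁)(𝔸)` (the rational points), a family of
test functions `φ_N` and a base point `g₀`: PerL's kernel `u ↦ θ_{φ_N}(g₀,u)` IS Weil's `Θ_{Φ_N}` along a
continuous map `s : U(W₁)(𝔸) → Mp(X)_A` carrying `Γ`-translates into `r_k(Ps_k)`-translates, for a Weil datum
satisfying Théorème 6. -/
structure WeilKernelLaw (DS : ThetaSeesawData) [Group DS.A₁] [TopologicalSpace DS.A₁]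
    (Γ : Subgroup DS.A₁) (φN : ℕ → DS.S₁) (g₀ : DS.G) where
  /-- P (carriers of [We64]): `Mp(X)_A`, `S(X_A)`, the action, `r_k(Ps(X)_k)`, `Θ` -/
  W : WeilThetaDatum.{0}
  /-- P BY NAME: [We64, n° 41, Théorème 6, p. 193] as landed (`WeilThetaDatum.ThetaContinuousInvariant`) -/
  print : W.ThetaContinuousInvariant
  /-- class U: the splitting `u ↦ ι_χ(g₀, u)` … -/
  s : DS.A₁ → W.Mp
  /-- … is continuous … -/
  hs : Continuous s
  /-- … and carries rational elements into `r_k(Ps_k)`-translates -/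
  hsΓ : ∀ γ ∈ Γ, ∀ u : DS.A₁, ∃ ρ ∈ W.rat, s (γ * u) = ρ * s u
  /-- DEF: `φ_N` as an element of Weil's `S(X_A)` -/
  Φ : ℕ → W.SX
  /-- DEF (PerL l. 266): `θ_{φ_N}(g₀, u) = Θ_{Φ_N}(s(u))` -/
  hF : ∀ (N : ℕ) (u : DS.A₁), DS.thetaKernel₁ (φN N) g₀ u = W.theta (Φ N) (s u)

namespace WeilKernelLaw

variable {DS : ThetaSeesawData} [Group DS.A₁] [TopologicalSpace DS.A₁]
variable {Γ : Subgroup DS.A₁} {φN : ℕ → DS.S₁} {g₀ : DS.G}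

/-- **`SupplyBridgeA.cont` from Théorème 6 (conjunct 1) along the continuous splitting.** -/
theorem cont (law : WeilKernelLaw DS Γ φN g₀) (N : ℕ) :
    Continuous fun u => DS.thetaKernel₁ (φN N) g₀ u :=
  (law.print.theta_comp_continuous (law.Φ N) law.hs).congr fun u => (law.hF N u).symm

/-- **`SupplyBridgeA.inv` from Théorème 6 (conjunct 2): left `Γ`-invariance of the kernel.** -/
theorem inv (law : WeilKernelLaw DS Γ φN g₀) (N : ℕ) :
    ∀ γ ∈ Γ, ∀ u : DS.A₁, DS.thetaKernel₁ (φN N) g₀ (γ * u) = DS.thetaKernel₁ (φN N) g₀ u := by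
  intro γ hγ u
  obtain ⟨ρ, hρ, hsu⟩ := law.hsΓ γ hγ u
  rw [law.hF, law.hF, hsu, law.print.theta_left_invariant (law.Φ N) hρ]

/-- The TAUTOLOGICAL Weil datum of a kernel already known to be continuous and `Γ`-invariant:
`Mp := U(W₁)(𝔸)`, `S := ℕ` (the indices of the family), `Θ_N := θ_{φ_N}(g₀, ·)`, `rat := Γ`, `s := id`. -/
def tautological (hc : ∀ N : ℕ, Continuous fun u => DS.thetaKernel₁ (φN N) g₀ u)
    (hi : ∀ N : ℕ, ∀ γ ∈ Γ, ∀ u : DS.A₁, DS.thetaKernel₁ (φN N) g₀ (γ * u) = DS.thetaKernel₁ (φN N) g₀ u) :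
    WeilKernelLaw DS Γ φN g₀ where
  W := { Mp := DS.A₁, SX := ℕ, act := fun _ N => N, rat := (Γ : Set DS.A₁),
         theta := fun N u => DS.thetaKernel₁ (φN N) g₀ u }
  print := ⟨hc, fun N γ hγ u => hi N γ hγ u⟩
  s := id
  hs := continuous_id
  hsΓ := fun γ hγ _ => ⟨γ, hγ, rfl⟩
  Φ := id
  hF := fun _ _ => rfl

/-- **CONSERVATIVITY**: the law is equivalent to the two fields it discharges. -/
theorem nonempty_iff :
    Nonempty (WeilKernelLaw DS Γ φN g₀) ↔
      (∀ N : ℕ, Continuous fun u => DS.thetaKernel₁ (φN N) g₀ u) ∧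
        ∀ N : ℕ, ∀ γ ∈ Γ, ∀ u : DS.A₁, DS.thetaKernel₁ (φN N) g₀ (γ * u) = DS.thetaKernel₁ (φN N) g₀ u :=
  ⟨fun ⟨law⟩ => ⟨law.cont, law.inv⟩, fun h => ⟨tautological h.1 h.2⟩⟩

end WeilKernelLaw

end PerL34
end HodgeCM

end
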